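import Summits.PneNP.PneNP.Theorems.OneSliceShallowSliceBoundSlices

/-!
# Route OneSlice, crux `ConstantBand` (stmt-PneNP-2834), line `flat-prior-relative-minterms`: negative correlation on a Hamming slice

Helper file (lead seat c7, 2026-08-17) for the unconditional low-exponent rungs of the crux schedule
(`Theorems/OneSliceConstantBandExponentOne.lean`). On the uniform measure of ONE Hamming slice `{x : |x| = ℓ}` of a
finite cube `ι → Bool`, two MONOTONE Boolean functions supported on DISJOINT coordinate sets (`f` reads only the
coordinates in `V`, `g` only those outside `V`) are negatively correlated:

  `#{x : |x| = ℓ, f x ∧ g x} · #{x : |x| = ℓ} ≤ #{x : |x| = ℓ, f x} · #{x : |x| = ℓ, g x}`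

(`fprm_slice_negCorr`; the special case of negative association of uniform fixed-size subsets that the rung needs).
Proof: condition on `t = |x ∩ V|`; given `t` the two halves are independent uniform slices of the sub-cubes, the
conditional mean of `f` is non-decreasing in `t` and that of `g` non-increasing (local LYM, the tree's
`card_acc_mul_le`), and a weighted Chebyshev sum inequality for oppositely monotone sequences
(`fprm_sum_mul_sum_le_of_cross`, proved by symmetrising a double sum) finishes. Stated over the landed vocabulary
`wt` (`Theorems/OneSliceSliceACZeroDefs.lean`) only; no definitions. [folklore]
-/

set_option linter.dupNamespace false

noncomputable section

namespace Summit.PneNP.PneNP.Cruxes.ConstantBand.FlatPriorRelativeMinterms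

open Finset
open Summit.PneNP.PneNP.Cruxes.SliceACZero.RussoWindowLadder (wt)
open Summit.PneNP.PneNP.Theorems.ShallowSliceBound (card_slice_eq_choose card_acc_le_card_slice card_acc_mul_le)

/-! ## A weighted Chebyshev sum inequality (oppositely monotone sequences, cross-multiplied form) -/

/-- **Weighted Chebyshev, cross-multiplied.** If `a/s` is non-decreasing and `b/r` non-increasing along `ℕ` (stated
without divisions: `a t · s u ≤ a u · s t` and `b u · r t ≤ b t · r u` for `t ≤ u`), then
`(Σ a·b)(Σ s·r) ≤ (Σ a·r)(Σ s·b)` over any finite index set. Proof: twice the difference is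
`Σ_{t,u} (r t · b u − b t · r u)(a t · s u − a u · s t) ≥ 0` termwise. [folklore] -/
theorem fprm_sum_mul_sum_le_of_cross (T : Finset ℕ) (a s b r : ℕ → ℝ)
    (ha : ∀ t u, t ≤ u → a t * s u ≤ a u * s t) (hb : ∀ t u, t ≤ u → b u * r t ≤ b t * r u) :
    (∑ t ∈ T, a t * b t) * (∑ t ∈ T, s t * r t) ≤ (∑ t ∈ T, a t * r t) * (∑ t ∈ T, s t * b t) := by
  have key : ∀ t u, 0 ≤ (r t * b u - b t * r u) * (a t * s u - a u * s t) := by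
    intro t u
    rcases le_total t u with h | h
    · exact mul_nonneg_of_nonpos_of_nonpos (by linarith [hb t u h]) (by linarith [ha t u h])
    · exact mul_nonneg (by linarith [hb u t h]) (by linarith [ha u t h])
  have hsum : 0 ≤ ∑ t ∈ T, ∑ u ∈ T, (r t * b u - b t * r u) * (a t * s u - a u * s t) :=
    sum_nonneg fun t _ => sum_nonneg fun u _ => key t u
  have hexp : ∀ t u, (r t * b u - b t * r u) * (a t * s u - a u * s t) =
      (a t * r t) * (s u * b u) - (s t * r t) * (a u * b u) - (a t * b t) * (s u * r u) + (s t * b t) * (a u * r u) := by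
    intro t u; ring
  have hid : ∑ t ∈ T, ∑ u ∈ T, (r t * b u - b t * r u) * (a t * s u - a u * s t) =
      2 * ((∑ t ∈ T, a t * r t) * (∑ t ∈ T, s t * b t) - (∑ t ∈ T, a t * b t) * (∑ t ∈ T, s t * r t)) := by
    simp only [hexp, sum_add_distrib, sum_sub_distrib, ← mul_sum, ← sum_mul]
    ring
  rw [hid] at hsum
  linarith

/-! ## Splitting a cube along a coordinate set -/

variable {ι : Type} [Fintype ι] [DecidableEq ι]

omit [DecidableEq ι] in
/-- The weight as a sum of indicators. [folklore] -/
theorem wt_eq_sum_ite (x : ι → Bool) : wt x = ∑ i, (if x i = true then 1 else 0) := by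
  rw [wt, card_filter]

/-- The weight splits along `V` and its complement. [folklore] -/
theorem wt_eq_wt_add_wt (V : Finset ι) (x : ι → Bool) :
    wt x = wt (fun a : V => x a) + wt (fun b : {i // i ∉ V} => x b) := by
  have h1 : #(univ.filter fun a : V => x a = true) =
      #((univ.filter fun i : ι => x i = true).filter fun i => i ∈ V) := by
    refine card_bij (fun (a : V) _ => (a : ι)) (fun a ha => ?_) (fun a _ b _ h => Subtype.ext h) (fun i hi => ?_)
    · simp only [mem_filter, mem_univ, true_and] at ha ⊢
      exact ⟨ha, a.2⟩
    · simp only [mem_filter, mem_univ, true_and] at hi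
      exact ⟨⟨i, hi.2⟩, by simpa using hi.1, rfl⟩
  have h2 : #(univ.filter fun b : {i // i ∉ V} => x b = true) =
      #((univ.filter fun i : ι => x i = true).filter fun i => i ∉ V) := by
    refine card_bij (fun (b : {i // i ∉ V}) _ => (b : ι)) (fun b hb => ?_) (fun a _ b _ h => Subtype.ext h)
      (fun i hi => ?_)
    · simp only [mem_filter, mem_univ, true_and] at hb ⊢
      exact ⟨hb, b.2⟩
    · simp only [mem_filter, mem_univ, true_and] at hi
      exact ⟨⟨i, hi.2⟩, by simpa using hi.1, rfl⟩
  simp only [wt]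
  rw [h1, h2, card_filter_add_card_filter_not]

/-- **Counting on a slice through the split** `x ↦ (x|_V, x|_{Vᶜ})`: the points of weight `ℓ` whose `V`-part
satisfies `P` and whose `Vᶜ`-part satisfies `Q` number `Σ_{t ≤ ℓ} #{σ : |σ| = t, P σ} · #{τ : |τ| = ℓ - t, Q τ}`. [folklore] -/
theorem card_filter_split (V : Finset ι) (P : (V → Bool) → Prop) (Q : ({i // i ∉ V} → Bool) → Prop)
    [DecidablePred P] [DecidablePred Q] (ℓ : ℕ) :
    #(univ.filter fun x : ι → Bool => wt x = ℓ ∧ P (fun a => x a) ∧ Q (fun b => x b)) =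
      ∑ t ∈ range (ℓ + 1), #(univ.filter fun σ : V → Bool => wt σ = t ∧ P σ) *
        #(univ.filter fun τ : {i // i ∉ V} → Bool => wt τ = ℓ - t ∧ Q τ) := by
  set e := Equiv.piEquivPiSubtypeProd (fun i => i ∈ V) (fun _ => Bool) with he
  set S : Finset ((V → Bool) × ({i // i ∉ V} → Bool)) :=
    univ.filter fun st => wt st.1 + wt st.2 = ℓ ∧ P st.1 ∧ Q st.2 with hS
  have h1 : #(univ.filter fun x : ι → Bool => wt x = ℓ ∧ P (fun a => x a) ∧ Q (fun b => x b)) = #S := by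
    refine card_equiv e fun x => ?_
    simp only [hS, mem_filter, mem_univ, true_and, wt_eq_wt_add_wt V x]
    exact Iff.rfl
  have h2 : #S = ∑ t ∈ range (ℓ + 1), #(S.filter fun st => wt st.1 = t) := by
    refine card_eq_sum_card_fiberwise fun st hst => ?_
    have hst' := Finset.mem_coe.1 hst
    rw [hS, mem_filter] at hst'
    rw [Finset.mem_coe, mem_range]
    omega
  rw [h1, h2]
  refine sum_congr rfl fun t ht => ?_
  rw [mem_range] at ht
  rw [← card_product]
  congr 1
  ext ⟨σ, τ⟩
  simp only [hS, mem_filter, mem_univ, true_and, mem_product]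
  constructor
  · rintro ⟨⟨hw, hP, hQ⟩, hσ⟩
    exact ⟨⟨hσ, hP⟩, by omega, hQ⟩
  · rintro ⟨⟨hσ, hP⟩, hτ, hQ⟩
    exact ⟨⟨by omega, hP, hQ⟩, hσ⟩

/-- Cross-multiplied monotonicity of slice averages of a monotone function, for ALL pairs of levels (the levels above
the dimension are empty). [folklore] -/
theorem card_acc_mul_le' {α : Type} [Fintype α] [DecidableEq α] {F : (α → Bool) → Bool} (hF : Monotone F)
    {t u : ℕ} (htu : t ≤ u) :
    (#(univ.filter fun σ : α → Bool => wt σ = t ∧ F σ = true) : ℝ) * #(univ.filter fun σ : α → Bool => wt σ = u) ≤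
      (#(univ.filter fun σ : α → Bool => wt σ = u ∧ F σ = true) : ℝ) * #(univ.filter fun σ : α → Bool => wt σ = t) := by
  rcases le_or_gt u (Fintype.card α) with hu | hu
  · exact card_acc_mul_le hF htu hu
  · have h0 : #(univ.filter fun σ : α → Bool => wt σ = u) = 0 := by
      rw [card_slice_eq_choose, Nat.choose_eq_zero_of_lt hu]
    have h0' : #(univ.filter fun σ : α → Bool => wt σ = u ∧ F σ = true) = 0 :=
      Nat.eq_zero_of_le_zero (h0 ▸ card_acc_le_card_slice F u)
    rw [h0, h0']
    simp

/-! ## Negative correlation of disjointly supported monotone functions on a slice -/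

/-- **Negative correlation on a slice.** For monotone `f` depending only on the coordinates in `V` and monotone `g`
depending only on the coordinates outside `V`, on every Hamming slice
`#{f ∧ g} · #slice ≤ #{f} · #{g}`. [folklore] -/
theorem fprm_slice_negCorr (V : Finset ι) {f g : (ι → Bool) → Bool} (hf : Monotone f) (hg : Monotone g)
    (hfV : ∀ x y : ι → Bool, (∀ i ∈ V, x i = y i) → f x = f y)
    (hgV : ∀ x y : ι → Bool, (∀ i ∉ V, x i = y i) → g x = g y) (ℓ : ℕ) :
    (#(univ.filter fun x : ι → Bool => wt x = ℓ ∧ (f x = true ∧ g x = true)) : ℝ) *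
        #(univ.filter fun x : ι → Bool => wt x = ℓ) ≤
      (#(univ.filter fun x : ι → Bool => wt x = ℓ ∧ f x = true) : ℝ) *
        #(univ.filter fun x : ι → Bool => wt x = ℓ ∧ g x = true) := by
  -- the induced functions on the two sub-cubes (extend by zeros off the sub-cube)
  set F : (V → Bool) → Bool := fun σ => f (fun i => if h : i ∈ V then σ ⟨i, h⟩ else false) with hF
  set G : ({i // i ∉ V} → Bool) → Bool := fun τ => g (fun i => if h : i ∈ V then false else τ ⟨i, h⟩) with hG
  have hFm : Monotone F := by
    intro σ σ' h
    apply hf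
    intro i
    dsimp only
    split_ifs with hi
    · exact h _
    · exact le_rfl
  have hGm : Monotone G := by
    intro τ τ' h
    apply hg
    intro i
    dsimp only
    split_ifs with hi
    · exact le_rfl
    · exact h _
  have hfF : ∀ x : ι → Bool, f x = F (fun a => x a) := fun x =>
    hfV x _ fun i hi => by simp [hi]
  have hgG : ∀ x : ι → Bool, g x = G (fun b => x b) := fun x =>
    hgV x _ fun i hi => by simp [hi]
  -- the four counts through the split
  set a : ℕ → ℝ := fun t => #(univ.filter fun σ : V → Bool => wt σ = t ∧ F σ = true) with ha
  set s : ℕ → ℝ := fun t => #(univ.filter fun σ : V → Bool => wt σ = t) with hs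
  set b : ℕ → ℝ := fun t => #(univ.filter fun τ : {i // i ∉ V} → Bool => wt τ = ℓ - t ∧ G τ = true) with hb
  set r : ℕ → ℝ := fun t => #(univ.filter fun τ : {i // i ∉ V} → Bool => wt τ = ℓ - t) with hr
  have e1 : (#(univ.filter fun x : ι → Bool => wt x = ℓ ∧ (f x = true ∧ g x = true)) : ℝ) =
      ∑ t ∈ range (ℓ + 1), a t * b t := by
    have h := card_filter_split V (fun σ => F σ = true) (fun τ => G τ = true) ℓ
    have h' : (univ.filter fun x : ι → Bool => wt x = ℓ ∧ (f x = true ∧ g x = true)) =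
        univ.filter fun x : ι → Bool => wt x = ℓ ∧ F (fun a => x a) = true ∧ G (fun b => x b) = true := by
      refine filter_congr fun x _ => ?_
      rw [hfF x, hgG x]
    rw [h', h]
    push_cast
    rfl
  have e2 : (#(univ.filter fun x : ι → Bool => wt x = ℓ) : ℝ) = ∑ t ∈ range (ℓ + 1), s t * r t := by
    have h := card_filter_split V (fun _ => True) (fun _ => True) ℓ
    simp only [and_true] at h
    rw [h]
    push_cast
    rfl
  have e3 : (#(univ.filter fun x : ι → Bool => wt x = ℓ ∧ f x = true) : ℝ) = ∑ t ∈ range (ℓ + 1), a t * r t := by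
    have h := card_filter_split V (fun σ => F σ = true) (fun _ => True) ℓ
    simp only [and_true] at h
    have h' : (univ.filter fun x : ι → Bool => wt x = ℓ ∧ f x = true) =
        univ.filter fun x : ι → Bool => wt x = ℓ ∧ F (fun a => x a) = true := by
      refine filter_congr fun x _ => ?_
      rw [hfF x]
    rw [h', h]
    push_cast
    rfl
  have e4 : (#(univ.filter fun x : ι → Bool => wt x = ℓ ∧ g x = true) : ℝ) = ∑ t ∈ range (ℓ + 1), s t * b t := by
    have h := card_filter_split V (fun _ => True) (fun τ => G τ = true) ℓ
    simp only [true_and, and_true] at h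
    have h' : (univ.filter fun x : ι → Bool => wt x = ℓ ∧ g x = true) =
        univ.filter fun x : ι → Bool => wt x = ℓ ∧ G (fun b => x b) = true := by
      refine filter_congr fun x _ => ?_
      rw [hgG x]
    rw [h', h]
    push_cast
    rfl
  rw [e1, e2, e3, e4]
  refine fprm_sum_mul_sum_le_of_cross (range (ℓ + 1)) a s b r (fun t u htu => ?_) (fun t u htu => ?_)
  · exact card_acc_mul_le' hFm htu
  · -- `ℓ - u ≤ ℓ - t`
    exact card_acc_mul_le' hGm (Nat.sub_le_sub_left htu ℓ)

/-- **Registered form** (sub-goal `fprm_sliceNegCorr` of stmt-PneNP-2834): negative correlation on a Hamming slice of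
two monotone functions supported on complementary coordinate sets, all binders explicit. [folklore] -/
theorem fprm_sliceNegCorr :
    ∀ (ι : Type) [Fintype ι] [DecidableEq ι] (V : Finset ι) (f g : (ι → Bool) → Bool), Monotone f → Monotone g →
      (∀ x y : ι → Bool, (∀ i ∈ V, x i = y i) → f x = f y) →
      (∀ x y : ι → Bool, (∀ i ∉ V, x i = y i) → g x = g y) → ∀ ℓ : ℕ,
      (#(univ.filter fun x : ι → Bool => wt x = ℓ ∧ (f x = true ∧ g x = true)) : ℝ) *
          #(univ.filter fun x : ι → Bool => wt x = ℓ) ≤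
        (#(univ.filter fun x : ι → Bool => wt x = ℓ ∧ f x = true) : ℝ) *
          #(univ.filter fun x : ι → Bool => wt x = ℓ ∧ g x = true) :=
  fun _ _ _ V _ _ hf hg hfV hgV ℓ => fprm_slice_negCorr V hf hg hfV hgV ℓ

end Summit.PneNP.PneNP.Cruxes.ConstantBand.FlatPriorRelativeMinterms

end
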